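import Mathlib
import HarnessLib
import Summits.AtomisticToContinuum.BoseEinsteinCondensation.Theses.NumberPhaseSandwich
import Summits.AtomisticToContinuum.BoseEinsteinCondensation.Theorems.NumberPhaseSandwichLossBookkeeping
import Literature.MathematicalPhysics.QuantumManyBody.BoseGasFreeDirichletBEC

/-! # NumberPhaseSandwich · PhaseSaturation · line «second-moment-near-pivot» · stub `stub_satNearPivot_of_secondMoment`

Registered stub of the skeleton `Cruxes/PhaseSaturation/Lines/PhaseSaturation_secondMoment.lean`
(crux `PhaseSaturation`, item stmt-AtomisticToContinuum-32637, route NumberPhaseSandwich):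

  `theorem stub_satNearPivot_of_secondMoment : PairSecondMomentP → StubNearPivot`

i.e. the PAIR NUMBER SECOND MOMENT bound I3 `⟨N_P²⟩_Ψ ≤ Cρ²ℓ⁶` (interior sibling pairs, pivot window `K ≤ k + m`)
implies the near-pivot SATURATION `dip(c,c')·Var(c,c') ≤ C'(ρ,m)·(n_c + n_c')`.  Proof: the bump difference
`g = h_c − h_c'` satisfies `|g| ≤ 1_P` (`P = Q_c ∪ Q_c'`), hence `|G(X)| = |Σ_p g(x_p)| ≤ N_P(X)` and
`Var ≤ ∫ |G|²|Ψ|² ≤ ⟨N_P²⟩ ≤ Cρ²ℓ⁶ ≤ C·2^(6(m+1))/ρ` in the window (`ℓ ≤ 2^m·L/2^K < 2^(m+1)/√ρ`); and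
`dip ≤ 2(n_c + n_c')` is `dip_le_two_mul` (Theorems/NumberPhaseSandwichLossBookkeeping).  The statement defs
(`occ`, `dip`, `bump`, `Var`, `Sib`, `IntP`, `pairCount`, `PairSecondMomentP`, `StubNearPivot`) are copied VERBATIM
from the registered skeleton. decomp-a2c lens-6 g10 (planner-decomp-a2c-lens-6-g10-0). -/

noncomputable section

namespace Summit.AtomisticToContinuum.BoseEinsteinCondensation.Theorems.NumberPhaseSandwichSatNearPivot

open Literature.MathematicalPhysics.QuantumManyBody.BoseGas Filter MeasureTheory
open scoped NNReal ENNReal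

/-- occupation of the flat sub-cell mode `u_c` at level `k`. -/
abbrev occ (ρ : ℝ) (N k : ℕ) (c : SubIdx (2 ^ k)) (Ψ : Config N → ℂ) : ENNReal :=
  occupation N (subMode (sideLength ρ N / 2 ^ k) c) Ψ
/-- DIPOLE occupation of the pair `(c, c')`: occupation of `u_c − u_c'` (the cascade's loss variable). -/
abbrev dip (ρ : ℝ) (N k : ℕ) (c c' : SubIdx (2 ^ k)) (Ψ : Config N → ℂ) : ENNReal :=
  occupation N (fun x => subMode (sideLength ρ N / 2 ^ k) c x - subMode (sideLength ρ N / 2 ^ k) c' x) Ψ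
/-- the C^∞ product bump of cell `c` at side `ℓ` (`≡ 1` on the middle half-cube, supported in the closed cell). -/
abbrev bump {m : ℕ} (ℓ : ℝ) (c : SubIdx m) (x : Space) : ℝ :=
  ∏ j : Fin 3, (Real.smoothTransition (4 * ((x j - ℓ * ((c j : ℕ) : ℝ)) / ℓ))) *
    Real.smoothTransition (4 * (1 - (x j - ℓ * ((c j : ℕ) : ℝ)) / ℓ))
/-- VARIANCE of the smoothed relative particle number of the pair `(c, c')`. -/
abbrev Var (ρ : ℝ) (N k : ℕ) (c c' : SubIdx (2 ^ k)) (Ψ : Config N → ℂ) : ENNReal :=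
  ⨅ m : ℂ, ∫⁻ X : Config N, (‖(∑ p : Fin N, (((bump (sideLength ρ N / 2 ^ k) c (X p)) -
    (bump (sideLength ρ N / 2 ^ k) c' (X p)) : ℝ) : ℂ)) - m‖₊ : ENNReal) ^ 2 * (‖Ψ X‖₊ : ENNReal) ^ 2
/-- siblings: same parent cell. -/
abbrev Sib {m : ℕ} (c c' : SubIdx m) : Prop := ∀ j : Fin 3, (c j : ℕ) / 2 = (c' j : ℕ) / 2
/-- the parent of `c` is an INTERIOR cell of level `k - 1`. -/
abbrev IntP (k : ℕ) (c : SubIdx (2 ^ k)) : Prop := ∀ j : Fin 3, 1 ≤ (c j : ℕ) / 2 ∧ (c j : ℕ) / 2 + 2 ≤ 2 ^ (k - 1)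

/-- number of particles of the configuration `X` in the sibling-pair region `Q_c ∪ Q_c'` (level `k`). -/
abbrev pairCount (ρ : ℝ) (N k : ℕ) (c c' : SubIdx (2 ^ k)) (X : Config N) : ENNReal :=
  ∑ p : Fin N, (subCell (sideLength ρ N / 2 ^ k) c ∪ subCell (sideLength ρ N / 2 ^ k) c').indicator
    (fun _ => (1 : ENNReal)) (X p)

/-- I3 · PAIR NUMBER SECOND MOMENT: `⟨N_P²⟩_Ψ ≤ C ρ² ℓ⁶` for every interior sibling pair in the pivot window (no
anomalous clustering of `≫ ρℓ³` particles in a pivot-scale pair region; `C = C(v,ρ,m)`). Same statement text as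
`stub_pairSecondMoment` of the FluctuationFloor line «kinematic-near-pivot». -/
def PairSecondMomentP : Prop :=
  ∀ v : ℝ → ENNReal, IsRepulsiveFiniteRange v → ∃ ρ₀ : ℝ, 0 < ρ₀ ∧ ∀ ρ : ℝ, 0 < ρ → ρ < ρ₀ →
    ∀ m : ℕ, ∃ C : ℝ, 0 < C ∧ ∃ c₀ : ℝ, 0 < c₀ ∧ ∀ᶠ N : ℕ in Filter.atTop, ∃ δ : ENNReal, 0 < δ ∧
      ∀ Ψ : TrialState N (sideLength ρ N), energy v Ψ ≤ groundStateEnergy v N (sideLength ρ N) + δ →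
        ENNReal.ofReal (c₀ * N) ≤ maxOccupation N Ψ.ψ ∨
          ∀ K k : ℕ, 1 / Real.sqrt ρ ≤ sideLength ρ N / 2 ^ K → sideLength ρ N / 2 ^ K < 2 * (1 / Real.sqrt ρ) →
            1 ≤ k → k ≤ K → K ≤ k + m →
            ∀ c c' : SubIdx (2 ^ k), c ≠ c' → Sib c c' → IntP k c →
              ∫⁻ X, pairCount ρ N k c c' X ^ 2 * (‖Ψ.ψ X‖₊ : ENNReal) ^ 2 ≤
                ENNReal.ofReal (C * ρ ^ 2 * (sideLength ρ N / 2 ^ k) ^ 6)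

/-- STUB A · SATURATION AT EVERY FIXED DEPTH BELOW THE PIVOT (`K ≤ k + m`, constant `C(ρ, m)`; BC5 plan-only rung). -/
def StubNearPivot : Prop :=
  ∀ v : ℝ → ENNReal, IsRepulsiveFiniteRange v → ∃ ρ₀ : ℝ, 0 < ρ₀ ∧ ∀ ρ : ℝ, 0 < ρ → ρ < ρ₀ →
    ∀ m : ℕ, ∃ C : ℝ, 0 < C ∧ ∃ c₀ : ℝ, 0 < c₀ ∧ ∀ᶠ N : ℕ in Filter.atTop, ∃ δ : ENNReal, 0 < δ ∧
      ∀ Ψ : TrialState N (sideLength ρ N), energy v Ψ ≤ groundStateEnergy v N (sideLength ρ N) + δ →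
        ENNReal.ofReal (c₀ * N) ≤ maxOccupation N Ψ.ψ ∨
          ∀ K k : ℕ, 1 / Real.sqrt ρ ≤ sideLength ρ N / 2 ^ K → sideLength ρ N / 2 ^ K < 2 * (1 / Real.sqrt ρ) →
            1 ≤ k → k ≤ K → K ≤ k + m →
            ∀ c c' : SubIdx (2 ^ k), c ≠ c' → Sib c c' → IntP k c →
              dip ρ N k c c' Ψ.ψ * Var ρ N k c c' Ψ.ψ ≤ ENNReal.ofReal C * (occ ρ N k c Ψ.ψ + occ ρ N k c' Ψ.ψ)


/-! ## Bump bounds -/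

section Bump

variable {n : ℕ} {ℓ : ℝ}

/-- the cell bump is nonnegative. -/
theorem bump_nonneg (ℓ : ℝ) (c : SubIdx n) (x : Space) : 0 ≤ bump ℓ c x :=
  Finset.prod_nonneg fun _ _ =>
    mul_nonneg (Real.smoothTransition.nonneg _) (Real.smoothTransition.nonneg _)

/-- the cell bump is at most one. -/
theorem bump_le_one (ℓ : ℝ) (c : SubIdx n) (x : Space) : bump ℓ c x ≤ 1 :=
  Finset.prod_le_one (fun _ _ => mul_nonneg (Real.smoothTransition.nonneg _) (Real.smoothTransition.nonneg _))
    fun _ _ => mul_le_one₀ (Real.smoothTransition.le_one _) (Real.smoothTransition.nonneg _)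
      (Real.smoothTransition.le_one _)

/-- the bump of cell `c` vanishes off the (half-open) cell `Q_c`. -/
theorem bump_eq_zero_of_not_mem (hℓ : 0 < ℓ) (c : SubIdx n) {x : Space} (hx : x ∉ subCell ℓ c) :
    bump ℓ c x = 0 := by
  rw [mem_subCell] at hx
  simp only [not_forall, not_and, not_lt] at hx
  obtain ⟨i, hi⟩ := hx
  apply Finset.prod_eq_zero (Finset.mem_univ i)
  by_cases h1 : ℓ * ((c i : ℕ) : ℝ) ≤ x i
  · -- then `x i ≥ ℓ c_i + ℓ`: the second factor vanishes
    have h2 : ℓ * ((c i : ℕ) : ℝ) + ℓ ≤ x i := hi h1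
    have ht : 4 * (1 - (x i - ℓ * ((c i : ℕ) : ℝ)) / ℓ) ≤ 0 := by
      have : 1 ≤ (x i - ℓ * ((c i : ℕ) : ℝ)) / ℓ := by
        rw [le_div_iff₀ hℓ]; linarith
      linarith
    rw [Real.smoothTransition.zero_of_nonpos ht, mul_zero]
  · have h1' : x i < ℓ * ((c i : ℕ) : ℝ) := not_le.1 h1
    have ht : 4 * ((x i - ℓ * ((c i : ℕ) : ℝ)) / ℓ) ≤ 0 := by
      have : (x i - ℓ * ((c i : ℕ) : ℝ)) / ℓ ≤ 0 :=
        div_nonpos_of_nonpos_of_nonneg (by linarith) hℓ.le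
      linarith
    rw [Real.smoothTransition.zero_of_nonpos ht, zero_mul]

/-- `|h_c(x) − h_c'(x)| ≤ 1_{Q_c ∪ Q_c'}(x)`. -/
theorem abs_bump_sub_le_indicator (hℓ : 0 < ℓ) (c c' : SubIdx n) (x : Space) :
    |bump ℓ c x - bump ℓ c' x| ≤ (subCell ℓ c ∪ subCell ℓ c').indicator (fun _ => (1 : ℝ)) x := by
  by_cases hx : x ∈ subCell ℓ c ∪ subCell ℓ c'
  · rw [Set.indicator_of_mem hx, abs_sub_le_iff]
    constructor
    · linarith [bump_le_one ℓ c x, bump_nonneg ℓ c' x]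
    · linarith [bump_le_one ℓ c' x, bump_nonneg ℓ c x]
  · rw [Set.indicator_of_notMem hx]
    rw [Set.mem_union, not_or] at hx
    rw [bump_eq_zero_of_not_mem hℓ c hx.1, bump_eq_zero_of_not_mem hℓ c' hx.2, sub_zero, abs_zero]

/-- the real indicator as the `toReal` of the `ℝ≥0∞` indicator. -/
theorem indicator_real_eq_toReal (S : Set Space) (x : Space) :
    S.indicator (fun _ => (1 : ℝ)) x = (S.indicator (fun _ => (1 : ℝ≥0∞)) x).toReal := by
  by_cases hx : x ∈ S
  · simp [Set.indicator_of_mem hx]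
  · simp [Set.indicator_of_notMem hx]

/-- `‖Σ_p (h_c − h_c')(x_p)‖ ≤ N_P(X)` in `ℝ≥0∞`. -/
theorem ennnorm_sum_bump_sub_le {N : ℕ} (hℓ : 0 < ℓ) (c c' : SubIdx n) (X : Config N) :
    (‖(∑ p : Fin N, (((bump ℓ c (X p)) - (bump ℓ c' (X p)) : ℝ) : ℂ))‖₊ : ℝ≥0∞) ≤
      ∑ p : Fin N, (subCell ℓ c ∪ subCell ℓ c').indicator (fun _ => (1 : ℝ≥0∞)) (X p) := by
  have hfin : ∀ p : Fin N, (subCell ℓ c ∪ subCell ℓ c').indicator (fun _ => (1 : ℝ≥0∞)) (X p) ≠ ⊤ := by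
    intro p
    by_cases hx : X p ∈ subCell ℓ c ∪ subCell ℓ c'
    · simp [Set.indicator_of_mem hx]
    · simp [Set.indicator_of_notMem hx]
  rw [← ENNReal.ofReal_toReal (ENNReal.sum_ne_top.2 fun p _ => hfin p), ENNReal.toReal_sum fun p _ => hfin p]
  have h1 : (‖(∑ p : Fin N, (((bump ℓ c (X p)) - (bump ℓ c' (X p)) : ℝ) : ℂ))‖₊ : ℝ≥0∞) =
      ENNReal.ofReal ‖(∑ p : Fin N, (((bump ℓ c (X p)) - (bump ℓ c' (X p)) : ℝ) : ℂ))‖ := by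
    rw [← enorm_eq_nnnorm, ← ofReal_norm]
  rw [h1]
  apply ENNReal.ofReal_le_ofReal
  rw [← Complex.ofReal_sum, Complex.norm_real, Real.norm_eq_abs]
  refine (Finset.abs_sum_le_sum_abs _ _).trans (Finset.sum_le_sum fun p _ => ?_)
  rw [← indicator_real_eq_toReal]
  exact abs_bump_sub_le_indicator hℓ c c' (X p)

end Bump

/-! ## The variance is bounded by the pair-number second moment -/

/-- the relative-number variance of a sibling pair is bounded by the second moment of the pair occupation
`∫ N_P² ‖Ψ‖²` (take `m = 0` in the infimum and `|h_c − h_c'| ≤ 1_{Q_c ∪ Q_c'}`). -/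
theorem Var_le_secondMoment {ρ : ℝ} {N k : ℕ} (hℓ : 0 < sideLength ρ N / 2 ^ k) (c c' : SubIdx (2 ^ k))
    (Ψ : Config N → ℂ) :
    Var ρ N k c c' Ψ ≤ ∫⁻ X, pairCount ρ N k c c' X ^ 2 * (‖Ψ X‖₊ : ℝ≥0∞) ^ 2 := by
  refine (iInf_le _ (0 : ℂ)).trans (lintegral_mono fun X => ?_)
  rw [sub_zero]
  exact mul_le_mul' (pow_le_pow_left' (ennnorm_sum_bump_sub_le hℓ c c' X) 2) le_rfl

/-! ## Window arithmetic -/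

/-- in the window `K ≤ k + m`, `L/2^K < 2/√ρ`: `ρ² (L/2^k)⁶ ≤ 2^(6(m+1))/ρ`. -/
theorem window_bound {ρ L : ℝ} (hρ : 0 < ρ) (hL : 0 ≤ L) {K k m : ℕ} (hK2 : L / 2 ^ K < 2 * (1 / Real.sqrt ρ))
    (hKkm : K ≤ k + m) : ρ ^ 2 * (L / 2 ^ k) ^ 6 ≤ 2 ^ (6 * (m + 1)) / ρ := by
  have hsq : 0 < Real.sqrt ρ := Real.sqrt_pos.2 hρ
  have hsq2 : Real.sqrt ρ ^ 2 = ρ := Real.sq_sqrt hρ.le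
  -- ℓ ≤ 2^m · L/2^K
  have h2k : (0 : ℝ) < 2 ^ k := by positivity
  have h2K : (0 : ℝ) < 2 ^ K := by positivity
  -- `2^K ≤ 2^m 2^k`
  have hpow : (2 : ℝ) ^ K ≤ 2 ^ m * 2 ^ k := by
    rw [← pow_add]
    exact pow_le_pow_right₀ (by norm_num) (by omega)
  -- ℓ ≤ 2^m · L/2^K
  have hℓ : L / 2 ^ k ≤ 2 ^ m * (L / 2 ^ K) := by
    rw [mul_div_assoc', div_le_div_iff₀ h2k h2K]
    calc L * 2 ^ K ≤ L * (2 ^ m * 2 ^ k) := mul_le_mul_of_nonneg_left hpow hL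
      _ = 2 ^ m * L * 2 ^ k := by ring
  have hℓ0 : 0 ≤ L / 2 ^ k := div_nonneg hL h2k.le
  -- ℓ √ρ < 2^(m+1)
  have hLK : L / 2 ^ K * Real.sqrt ρ < 2 := by
    have := mul_lt_mul_of_pos_right hK2 hsq
    rwa [mul_assoc, one_div, inv_mul_cancel₀ hsq.ne', mul_one] at this
  have hx : L / 2 ^ k * Real.sqrt ρ ≤ 2 ^ (m + 1) := by
    calc L / 2 ^ k * Real.sqrt ρ ≤ 2 ^ m * (L / 2 ^ K) * Real.sqrt ρ :=
          mul_le_mul_of_nonneg_right hℓ hsq.le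
      _ = 2 ^ m * (L / 2 ^ K * Real.sqrt ρ) := by ring
      _ ≤ 2 ^ m * 2 := mul_le_mul_of_nonneg_left hLK.le (by positivity)
      _ = 2 ^ (m + 1) := by ring
  have hx0 : 0 ≤ L / 2 ^ k * Real.sqrt ρ := mul_nonneg hℓ0 hsq.le
  have hx6 : (L / 2 ^ k * Real.sqrt ρ) ^ 6 ≤ (2 ^ (m + 1)) ^ 6 := pow_le_pow_left₀ hx0 hx 6
  rw [le_div_iff₀ hρ]
  have key : (L / 2 ^ k * Real.sqrt ρ) ^ 6 = ρ ^ 2 * (L / 2 ^ k) ^ 6 * ρ := by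
    have : (L / 2 ^ k * Real.sqrt ρ) ^ 6 = (L / 2 ^ k) ^ 6 * (Real.sqrt ρ ^ 2) ^ 3 := by ring
    rw [this, hsq2]; ring
  calc ρ ^ 2 * (L / 2 ^ k) ^ 6 * ρ = (L / 2 ^ k * Real.sqrt ρ) ^ 6 := key.symm
    _ ≤ (2 ^ (m + 1)) ^ 6 := hx6
    _ = 2 ^ (6 * (m + 1)) := by rw [← pow_mul, mul_comm]

/-! ## The registered stub, by name -/

/-- **`stub_satNearPivot_of_secondMoment`** (line «second-moment-near-pivot» of crux `PhaseSaturation`). -/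
theorem stub_satNearPivot_of_secondMoment : PairSecondMomentP → StubNearPivot := by
  intro h v hv
  obtain ⟨ρ₀, hρ₀, H⟩ := h v hv
  refine ⟨ρ₀, hρ₀, fun ρ hρ hρlt m => ?_⟩
  obtain ⟨C, hC, c₀, hc₀, hev⟩ := H ρ hρ hρlt m
  refine ⟨2 * (C * (2 ^ (6 * (m + 1)) / ρ)), by positivity, c₀, hc₀, ?_⟩
  filter_upwards [hev] with N hN
  obtain ⟨δ, hδ, hΨ⟩ := hN
  refine ⟨δ, hδ, fun Ψ hE => ?_⟩
  rcases hΨ Ψ hE with hesc | hmom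
  · exact Or.inl hesc
  refine Or.inr fun K k hK1 hK2 hk1 hkK hKkm c c' hne hsib hint => ?_
  have hsq : 0 < Real.sqrt ρ := Real.sqrt_pos.2 hρ
  have hLK : 0 < sideLength ρ N / 2 ^ K := lt_of_lt_of_le (by positivity) hK1
  have hL : 0 < sideLength ρ N := by
    have h2K : (0 : ℝ) < 2 ^ K := by positivity
    have := mul_pos hLK h2K
    rwa [div_mul_cancel₀ _ h2K.ne'] at this
  have hℓ : 0 < sideLength ρ N / 2 ^ k := by positivity
  -- the three ingredients
  have h1 : dip ρ N k c c' Ψ.ψ ≤ 2 * (occ ρ N k c Ψ.ψ + occ ρ N k c' Ψ.ψ) :=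
    NumberPhaseSandwichLossBookkeeping.dip_le_two_mul hℓ c c' Ψ
  have h2 : Var ρ N k c c' Ψ.ψ ≤ ENNReal.ofReal (C * (2 ^ (6 * (m + 1)) / ρ)) := by
    refine (Var_le_secondMoment hℓ c c' Ψ.ψ).trans ((hmom K k hK1 hK2 hk1 hkK hKkm c c' hne hsib hint).trans ?_)
    apply ENNReal.ofReal_le_ofReal
    have hw := window_bound hρ hL.le hK2 hKkm
    calc C * ρ ^ 2 * (sideLength ρ N / 2 ^ k) ^ 6 = C * (ρ ^ 2 * (sideLength ρ N / 2 ^ k) ^ 6) := by ring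
      _ ≤ C * (2 ^ (6 * (m + 1)) / ρ) := mul_le_mul_of_nonneg_left hw hC.le
  calc dip ρ N k c c' Ψ.ψ * Var ρ N k c c' Ψ.ψ
      ≤ (2 * (occ ρ N k c Ψ.ψ + occ ρ N k c' Ψ.ψ)) * ENNReal.ofReal (C * (2 ^ (6 * (m + 1)) / ρ)) :=
        mul_le_mul' h1 h2
    _ = ENNReal.ofReal (2 * (C * (2 ^ (6 * (m + 1)) / ρ))) * (occ ρ N k c Ψ.ψ + occ ρ N k c' Ψ.ψ) := by
        rw [ENNReal.ofReal_mul (by norm_num : (0 : ℝ) ≤ 2), ENNReal.ofReal_ofNat]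
        ring

end Summit.AtomisticToContinuum.BoseEinsteinCondensation.Theorems.NumberPhaseSandwichSatNearPivot

end
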